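import Mathlib.LinearAlgebra.Matrix.Kronecker
import Literature.MathematicalPhysics.QuantumLattice.ProductOperators
import HarnessLib

/-!
# Ginibre's doubled system for spin ½ (Benassi–Lees–Ueltschi 2016, §3): definitions

The vocabulary of J. Ginibre's proof scheme for Griffiths inequalities of the second kind, in
the form used by C. Benassi, B. Lees, D. Ueltschi, *Correlation inequalities for the quantum XY
model*, J. Stat. Phys. 164 (2016) 1157–1166 (arXiv:1510.03215), §3, for the spin-½ quantum XY
model (held: `paper:arxiv-1510.03215`, §3 = materialised p0005). Everything is finite-dimensional
matrix algebra in the `ℓ²(Λ → Fin q)` picture of `SpinSystem.lean` / `ProductOperators.lean`: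

* `dblEquiv Λ : (Λ → Fin 2) × (Λ → Fin 2) ≃ (Λ → Fin 4)` — the product space `𝓗_Λ ⊗ 𝓗_Λ` of two
  copies of the spin-½ system IS the four-state spin system on the same `Λ`, site by site
  (`ℂ² ⊗ ℂ² ≅ ℂ⁴`, `(i, j) ↦ 2i + j` = Mathlib's `finProdFinEquiv`); this lets the tree's
  `onSite` / `productOp` API act on the doubled system (`Op Λ 4`);
* `dblLeft Λ a = a ⊗ 𝟙`, `dblRight Λ a = 𝟙 ⊗ a` (`ℂ`-algebra homomorphisms `Op Λ 2 →ₐ[ℂ] Op Λ 4`,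
  Kronecker products transported along `dblEquiv`), and BLU's `a₊ = a ⊗ 𝟙 + 𝟙 ⊗ a`,
  `a₋ = a ⊗ 𝟙 - 𝟙 ⊗ a` (`dblPlus`, `dblMinus`, `ℂ`-linear);
* BLU Lemma 8: the unitary `bluBasis = bluBasisAux / √2` on `ℂ⁴` in whose basis
  `σˣ₊, σˣ₋, σʸ₊, -σʸ₋` are entrywise nonnegative (BLU state it for the spin directions `1, 3`;
  the tree's XY model `xyPairFieldHamiltonian` lives in directions `0, 1` = `σˣ, σʸ`, so the site
  rotation `(𝟙 - iσˣ)/√2`, `σʸ ↦ σᶻ`, is built into `bluBasisAux`), the product unitary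
  `ginibreU Λ = ⨂_x bluBasis` and the conjugation `ginibreConj Λ X = U X U†` (an algebra
  endomorphism of `Op Λ 4`).

Only the definitions and the handful of identities needed to state them soundly (unitarity) live
here; BLU Lemmas 6–8 and Theorem 1 / Corollary 2 are PROVED in the sibling files
`GinibreDoublingProofs.lean` and `XYGriffithsBLUProofs.lean`. No named facts.

## References

* C. Benassi, B. Lees, D. Ueltschi, J. Stat. Phys. 164 (2016) 1157 = arXiv:1510.03215, §3
  (product space, `a_±`, Lemmas 6–8). [BenassiLeesUeltschi2016]
* J. Ginibre, *General formulation of Griffiths' inequalities*, Comm. Math. Phys. 16 (1970)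
  310–328 (the doubling scheme BLU follow). [Ginibre1970]

## Design notes

* The doubled local index is `Fin 4` (not `Fin 2 × Fin 2`) so that `onSite`, `productOp`,
  `productOp_conj_onSite` of the tree apply verbatim; `finProdFinEquiv : Fin 2 × Fin 2 ≃ Fin 4`
  is abbreviated `dblFin`.
* `bluBasisAux` has entries in `{0, ±1, ±i}`; all `4 × 4` identities are checked entrywise by
  `fin_cases`/`simp` on it, and the factor `1/√2` is restored once (`bluBasis_conj_eq` in the
  proofs file).
-/

noncomputable section

namespace Literature.MathematicalPhysics.QuantumLattice

open Matrix Complex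
open scoped Kronecker

/-- The single-site doubled index `Fin 2 × Fin 2 ≃ Fin 4`, `(i, j) ↦ 2 i + j` (Mathlib's
`finProdFinEquiv`, under a short reducible name). [folklore] -/
abbrev dblFin : Fin 2 × Fin 2 ≃ Fin 4 := finProdFinEquiv

section Doubling

variable (Λ : Type*) [Fintype Λ] [DecidableEq Λ]

/-- **The doubled configuration space.** A pair of spin-½ configurations `(σ, σ')` is the same as
one configuration of a four-state spin system, site by site: `(σ, σ') ↦ (x ↦ 2 σ_x + σ'_x)`.
This identifies Ginibre's product space `𝓗_Λ ⊗ 𝓗_Λ` of BLU §3 with `⨂_x (ℂ² ⊗ ℂ²) = ⨂_x ℂ⁴`.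
[cite: BenassiLeesUeltschi2016, §3 (product space)] -/
def dblEquiv : TensorIndex Λ 2 × TensorIndex Λ 2 ≃ TensorIndex Λ 4 where
  toFun p := fun y => dblFin (p.1 y, p.2 y)
  invFun τ := (fun y => (dblFin.symm (τ y)).1, fun y => (dblFin.symm (τ y)).2)
  left_inv p := by
    ext y <;> simp
  right_inv τ := by
    funext y
    simp

variable {Λ}

omit [Fintype Λ] [DecidableEq Λ] in
/-- Unfolding `dblEquiv.symm`. [folklore] -/
theorem dblEquiv_symm_apply (τ : TensorIndex Λ 4) :
    (dblEquiv Λ).symm τ = (fun y => (dblFin.symm (τ y)).1, fun y => (dblFin.symm (τ y)).2) := rfl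

omit [Fintype Λ] [DecidableEq Λ] in
/-- Unfolding `dblEquiv`. [folklore] -/
theorem dblEquiv_apply (p : TensorIndex Λ 2 × TensorIndex Λ 2) :
    dblEquiv Λ p = fun y => dblFin (p.1 y, p.2 y) := rfl

variable (Λ)

/-- **Left embedding** `a ↦ a ⊗ 𝟙` of the observables into the doubled system (as an operator on
`⨂_x ℂ⁴`), a `ℂ`-algebra homomorphism. [cite: BenassiLeesUeltschi2016, §3 (definition of a_±)] -/
def dblLeft : Op Λ 2 →ₐ[ℂ] Op Λ 4 :=
  AlgHom.ofLinearMap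
    { toFun := fun a => reindex (dblEquiv Λ) (dblEquiv Λ) (a ⊗ₖ (1 : Op Λ 2))
      map_add' := fun a b => by rw [add_kronecker]; rfl
      map_smul' := fun c a => by rw [smul_kronecker]; rfl }
    (by simp)
    (fun a b => by
      have h := map_mul (reindexAlgEquiv ℂ ℂ (dblEquiv Λ)) (a ⊗ₖ (1 : Op Λ 2)) (b ⊗ₖ (1 : Op Λ 2))
      simp only [coe_reindexAlgEquiv, ← mul_kronecker_mul, Matrix.mul_one] at h
      simpa using h)

/-- **Right embedding** `a ↦ 𝟙 ⊗ a` of the observables into the doubled system, a `ℂ`-algebra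
homomorphism. [cite: BenassiLeesUeltschi2016, §3 (definition of a_±)] -/
def dblRight : Op Λ 2 →ₐ[ℂ] Op Λ 4 :=
  AlgHom.ofLinearMap
    { toFun := fun a => reindex (dblEquiv Λ) (dblEquiv Λ) ((1 : Op Λ 2) ⊗ₖ a)
      map_add' := fun a b => by rw [kronecker_add]; rfl
      map_smul' := fun c a => by rw [kronecker_smul]; rfl }
    (by simp)
    (fun a b => by
      have h := map_mul (reindexAlgEquiv ℂ ℂ (dblEquiv Λ)) ((1 : Op Λ 2) ⊗ₖ a) ((1 : Op Λ 2) ⊗ₖ b)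
      simp only [coe_reindexAlgEquiv, ← mul_kronecker_mul, Matrix.mul_one] at h
      simpa using h)

variable {Λ}

/-- Unfolding `dblLeft`. [folklore] -/
theorem dblLeft_apply (a : Op Λ 2) :
    dblLeft Λ a = reindex (dblEquiv Λ) (dblEquiv Λ) (a ⊗ₖ (1 : Op Λ 2)) := rfl

/-- Unfolding `dblRight`. [folklore] -/
theorem dblRight_apply (a : Op Λ 2) :
    dblRight Λ a = reindex (dblEquiv Λ) (dblEquiv Λ) ((1 : Op Λ 2) ⊗ₖ a) := rfl

variable (Λ)

/-- **Ginibre's symmetric doubling** `a ↦ a₊ = a ⊗ 𝟙 + 𝟙 ⊗ a` (a `ℂ`-linear map into the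
observables of the doubled system). [cite: BenassiLeesUeltschi2016, §3 (definition of a_±)] -/
def dblPlus : Op Λ 2 →ₗ[ℂ] Op Λ 4 := (dblLeft Λ).toLinearMap + (dblRight Λ).toLinearMap

/-- **Ginibre's antisymmetric doubling** `a ↦ a₋ = a ⊗ 𝟙 - 𝟙 ⊗ a`.
[cite: BenassiLeesUeltschi2016, §3 (definition of a_±)] -/
def dblMinus : Op Λ 2 →ₗ[ℂ] Op Λ 4 := (dblLeft Λ).toLinearMap - (dblRight Λ).toLinearMap

variable {Λ}

/-- Unfolding `a₊ = a ⊗ 𝟙 + 𝟙 ⊗ a`. [folklore] -/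
theorem dblPlus_apply (a : Op Λ 2) : dblPlus Λ a = dblLeft Λ a + dblRight Λ a := rfl

/-- Unfolding `a₋ = a ⊗ 𝟙 - 𝟙 ⊗ a`. [folklore] -/
theorem dblMinus_apply (a : Op Λ 2) : dblMinus Λ a = dblLeft Λ a - dblRight Λ a := rfl

end Doubling

/-! ### BLU Lemma 8: the good basis of `ℂ² ⊗ ℂ² ≅ ℂ⁴` -/

section Basis

/-- `√2` times the **BLU basis change** on `ℂ² ⊗ ℂ² ≅ ℂ⁴`: its rows are `√2` times the conjugated
coordinates of the orthonormal basis `p₊, q₊, p₋, q₋` of [BLU, Lemma 8], precomposed with the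
site rotation `(𝟙 - iσˣ)/√2 ⊗ (𝟙 - iσˣ)/√2` taking the spin direction `2` (`σʸ`) to direction `3`
(`σᶻ`) (BLU work in the `1`–`3` plane; the tree's XY model lives in the `1`–`2` plane).
[cite: BenassiLeesUeltschi2016, Lemma 8] -/
def bluBasisAux : Matrix (Fin 4) (Fin 4) ℂ :=
  !![0, -I, -I, 0; -I, 0, 0, -I; 1, 0, 0, -1; 0, -1, 1, 0]

/-- The adjoint of `bluBasisAux`. [folklore] -/
theorem bluBasisAux_conjTranspose :
    bluBasisAuxᴴ = !![0, I, 1, 0; I, 0, 0, -1; I, 0, 0, 1; 0, I, -1, 0] := by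
  ext k l
  fin_cases k <;> fin_cases l <;> simp [bluBasisAux, conjTranspose_apply]

/-- `bluBasisAux` is `√2` times a unitary. [cite: BenassiLeesUeltschi2016, Lemma 8] -/
theorem bluBasisAux_mul_conjTranspose : bluBasisAux * bluBasisAuxᴴ = (2 : ℂ) • 1 := by
  rw [bluBasisAux_conjTranspose, bluBasisAux]
  ext k l
  fin_cases k <;> fin_cases l <;> simp [Matrix.mul_apply, Fin.sum_univ_four] <;> ring

/-- **The BLU basis change** `U₀ = bluBasisAux / √2`, a unitary on `ℂ² ⊗ ℂ² ≅ ℂ⁴`.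
[cite: BenassiLeesUeltschi2016, Lemma 8] -/
def bluBasis : Matrix (Fin 4) (Fin 4) ℂ := (((Real.sqrt 2)⁻¹ : ℝ) : ℂ) • bluBasisAux

/-- `(1/√2)² · 2 = 1`. [folklore] -/
theorem sqrt_two_inv_mul_self_mul_two :
    (((Real.sqrt 2)⁻¹ : ℝ) : ℂ) * (((Real.sqrt 2)⁻¹ : ℝ) : ℂ) * 2 = 1 := by
  have h : (Real.sqrt 2)⁻¹ * (Real.sqrt 2)⁻¹ = (2 : ℝ)⁻¹ := by
    rw [← mul_inv, Real.mul_self_sqrt zero_le_two]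
  rw [← Complex.ofReal_mul, h]
  push_cast
  exact inv_mul_cancel₀ two_ne_zero

/-- `U₀ U₀† = 𝟙`. [cite: BenassiLeesUeltschi2016, Lemma 8] -/
theorem bluBasis_mul_conjTranspose : bluBasis * bluBasisᴴ = 1 := by
  rw [bluBasis, conjTranspose_smul, Matrix.smul_mul, Matrix.mul_smul, smul_smul,
    bluBasisAux_mul_conjTranspose, smul_smul, Complex.star_def, Complex.conj_ofReal,
    sqrt_two_inv_mul_self_mul_two, one_smul]

/-- `U₀† U₀ = 𝟙`. [cite: BenassiLeesUeltschi2016, Lemma 8] -/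
theorem bluBasis_conjTranspose_mul : bluBasisᴴ * bluBasis = 1 :=
  mul_eq_one_comm.mp bluBasis_mul_conjTranspose

end Basis

section GoodBasis

variable {Λ : Type*} [Fintype Λ] [DecidableEq Λ]

variable (Λ)

/-- **The good basis of the doubled system** `U = ⨂_x U₀`, a product unitary on `⨂_x ℂ⁴`.
[cite: BenassiLeesUeltschi2016, Lemma 8] -/
def ginibreU : Op Λ 4 := productOp fun _ => bluBasis

variable {Λ}

/-- `U U† = 𝟙`. [cite: BenassiLeesUeltschi2016, Lemma 8] -/
theorem ginibreU_mul_conjTranspose : ginibreU Λ * (ginibreU Λ)ᴴ = 1 :=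
  productOp_mul_conjTranspose fun _ => bluBasis_mul_conjTranspose

/-- `U† U = 𝟙`. [cite: BenassiLeesUeltschi2016, Lemma 8] -/
theorem ginibreU_conjTranspose_mul : (ginibreU Λ)ᴴ * ginibreU Λ = 1 :=
  productOp_conjTranspose_mul fun _ => bluBasis_conjTranspose_mul

/-- `U` acts on single-site operators of the doubled system by the local basis change `U₀`.
[cite: BenassiLeesUeltschi2016, Lemma 8] -/
theorem ginibreU_conj_onSite (x : Λ) (M : Matrix (Fin 4) (Fin 4) ℂ) :
    ginibreU Λ * onSite x M * (ginibreU Λ)ᴴ = onSite x (bluBasis * M * bluBasisᴴ) :=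
  productOp_conj_onSite (fun _ => bluBasis_mul_conjTranspose) x M

variable (Λ)

/-- **Conjugation by the good basis**, `X ↦ U X U†`, a `ℂ`-algebra endomorphism of the
observables of the doubled system (an automorphism, `U` being unitary).
[cite: BenassiLeesUeltschi2016, Lemma 8] -/
def ginibreConj : Op Λ 4 →ₐ[ℂ] Op Λ 4 :=
  AlgHom.ofLinearMap
    { toFun := fun X => ginibreU Λ * X * (ginibreU Λ)ᴴ
      map_add' := fun X Y => by rw [Matrix.mul_add, Matrix.add_mul]
      map_smul' := fun c X => by rw [Matrix.mul_smul, Matrix.smul_mul, RingHom.id_apply] }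
    (by
      show ginibreU Λ * 1 * (ginibreU Λ)ᴴ = 1
      rw [Matrix.mul_one, ginibreU_mul_conjTranspose])
    (fun X Y => productOp_conj_mul (fun _ => bluBasis_conjTranspose_mul) X Y)

variable {Λ}

/-- Unfolding `ginibreConj`. [folklore] -/
theorem ginibreConj_apply (X : Op Λ 4) : ginibreConj Λ X = ginibreU Λ * X * (ginibreU Λ)ᴴ := rfl

end GoodBasis

end Literature.MathematicalPhysics.QuantumLattice
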